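/-
Copyright (c) 2026 the pub-hodgecm-mathlib formalisation cell (harness21).  Prover seat hodgecm-mathlib-LH4-p05 (g4): Track A «(D-RAM) FOUR-FRAME» squad of crux H413, organ T2c
«GLUE FIXED» of the (ρ2b′-X) payer ORDER v1 (`F0/P3c/LH4/LH4-p14/g3/RHO2BX-ORDER.v1.LH4p14g3.md`; deal LH4-p14 (g3) 2026-09-04T03:55:54Z (3)), 2026-09-04.
-/
import Literature.NumberTheory.Automorphic.UnitaryLatticeTreeBlockGlueFibre      -- ★ T2a p857187 (LH4-p14 (g3)): `glueData_of_generator`; brings ★ TubeAxisVertex, ★ TubeCoordinate (`exists_smul_add_of_tubeCoordinate`, `endoGL_mulVec_*`, `endoShapeForm_*`), ★ BlockGluing, ★ BlockSelfDualData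
import Literature.NumberTheory.Automorphic.UnitaryLatticeTreeBlockTubeCriterion  -- ★ p847270 + ED. 2 (F0P3a-p07 (g13)): (TC) `sub_smul_mulVec_proj_mem_of_forall_mulVec_mem`, `mulVec_mem_of_forall_sub_smul_mulVec_proj_mem`, `mulVec_mem_inf_of_forall_mulVec_mem`, (TC′) `forall_mulVec_mem_iff_sub_smul_mulVec_proj_mem_of_generator`
import Literature.NumberTheory.Automorphic.UnitaryLatticeTreeApartment          -- ★ (B-p14): `dualLatt_mapGL` (the dual is `U(σ,H)`-equivariant), `dualLatt_eq_self_of_isSelfDualLattice`, `mem_mapGL_iff`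
import HarnessLib

/-!
# The lattice graph of a hermitian space — THE GLUE FIBRE UNDER A BLOCK ELEMENT: a glued self-dual `M = B ⊔ 𝒪x₀` is fixed by `Γ = ι(γ₂, u)` iff `Γ` stabilises the
# `W`-part `B` and `(Γ − u)·pr_W x₀ ∈ B`; the axis fibre `b = 0`; the plane bridge `ι_W : K² → W` (Kottwitz 1986 §3; Bruhat–Tits 1972 §10; Jacobowitz 1962 §4)

Topic `NumberTheory/Automorphic`; namespace `Literature.NumberTheory.Automorphic.UnitaryLatticeTree`.  THEOREMS ONLY (no definition, no instance, no notation, no named fact,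
no `sorry`); kernel lane `--supports stmt-HodgeConjecture-24833`; DATUM-FREE (`K` with `Valued K ℤᵐ⁰`, `σ` a valuation-preserving ring endomorphism, `|ϖ| = exp(−1)`; no
`|2| = 1`, no `σϖ = ±ϖ`).  Cell `pub/hodgecm-mathlib`, crux H413 = `stmt-HodgeConjecture-24833`; squad F0∕P3c∕LH4 «(D-RAM) FOUR-FRAME», the WILD type-(2) G-side census (ρ2b′-X)
of `Cruxes/H413/Lines/F0_P3c_DyRamFourFrame_U2H_HSide.lean` :418 (payer plan LH4-p12 (g3) v2 8ff3a79c D5; payer ORDER v1 organs O-Ax ∕ O-Cone — the `Γ`-fixed refinement of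
★ T2a `UnitaryLatticeTreeBlockGlueFibre` and the hinge to LH4-p12 (g4)'s plane currency T3 `EllipticPlaneAsFieldLine`).
HONEST LABEL: HC_CM is proved only modulo the 7 printed citations (hLiu418 = stmt-HodgeConjecture-24832, h413 = stmt-HodgeConjecture-24833) until rung 0 closes; lattice algebra only.

THE MATHEMATICS (BLOCK CURRENCY of ★ `UnitaryLatticeTreeTubeCoordinate` ∕ ★ T2a: `V = K³ = W ⊕ Ke₁`, `W = {x | x₁ = 0} = ker pr₁`, form `H = !![H₂ 0 0, 0, H₂ 0 1; 0, h, 0;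
H₂ 1 0, 0, H₂ 1 1]`, `pr_W x = x − x₁e₁`; a BLOCK ELEMENT `Γ = ι(γ₂, u) = endoGL (γ₂, u)` acts by `γ₂` on `W` and by the scalar `u` on `e₁`).
* §1 **FIXED ⟺ STABLE for self-dual lattices** (`mapGL_eq_iff_forall_mulVec_mem_of_isSelfDualLattice`, any rank): for `Γ ∈ U(σ, H)` and `M` self-dual, `Γ·M = M ⟺ Γ·M ⊆ M`
  (`Γ·M ⊆ M ⇒ M = M^♯ ⊆ (Γ·M)^♯ = Γ·M^♯ = Γ·M`).  **THE Γ-FIXED REFINEMENT OF THE GLUE FIBRE** (`mapGL_endoGL_eq_iff_of_generator`): for a self-dual `M` with tube coordinate `b ≥ 1` and generator `x₀` (so `M = B ⊔ 𝒪x₀`, `B = M ∩ W`,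
  ★ T2a §1) and a block `Γ = ι(γ₂, u) ∈ U(σ, H)` with `|u| ≤ 1`:  `Γ·M = M ⟺ (Γ·B ⊆ B) ∧ (Γ − u)·pr_W x₀ ∈ B` — §1's equivalence followed by the ★ one-generator tube test (TC′)
  (`pr_W M = 𝒪·pr_W x₀ + B`, ★ `exists_smul_add_of_tubeCoordinate`); the two witnesses lie in `W` automatically (row `1` of `Γ`).
* §2 **THE AXIS FIBRE `b = 0`** (`mapGL_endoGL_eq_iff_of_single_one_mem`): if `e₁ ∈ M` (self-dual) then `|x₁| ≤ 1` on `M` (`M ≤ M^♯ ≤ (𝒪e₁)^♯`), `pr_W M = M ∩ W = B`,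
  `M = B ⊔ 𝒪e₁` (`eq_inf_kerProj_sup_span_single_one`), and `Γ·M = M ⟺ Γ·B ⊆ B` (the TC witnesses `(Γ − u)·pr_W x` are `Γ y − u y`, `y ∈ B`).
* §3 **THE PLANE BRIDGE** `ι_W y = (y₀, 0, y₁) = !![1, 0; 0, 0; 0, 1] *ᵥ y`: `⟨ι x, ι y⟩_H = ⟨x, y⟩_{H₂}`; `w ∈ B₂.map ι_W ⟺ w₁ = 0 ∧ (w₀, w₂) ∈ B₂`; the `Γ`-stability and generator
  conditions of §1∕§2 read on `K²` (`γ₂·B₂ ⊆ B₂`, `γ₂ w₀ − u w₀ ∈ B₂`); ★ T2a's gluing condition (G1) for `(B₂.map ι_W, x₀)` with `pr_W x₀ = ι_W w₀` ⟺ `(B₂ ⊔ 𝒪w₀)^♯_{H₂} = B₂`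
  (`glueCondition_map_planeMatrix_iff_dualLatt_sup_span_eq`) — the hinge to the plane-side census (LH4-p12 (g4) T3); §4: for `e₁ ∈ M` self-dual, `M ∩ W = ι_W(g₂·𝒪²)`, `g₂·𝒪²` self-dual for `H₂`.

## References
* [Kottwitz1986BaseChangeUnits] R. E. Kottwitz, *Base change for unit elements of Hecke algebras*, Compositio Math. 60 (1986), §1 pp. 240–241, §3.  [BruhatTits1972] F. Bruhat, J. Tits, *Groupes réductifs sur un corps
  local I*, Publ. Math. IHÉS 41 (1972), §10.  [Jacobowitz1962] R. Jacobowitz, *Hermitian forms over local fields*, Amer. J. Math. 84 (1962), §4.  [Rogawski1990] J. D. Rogawski,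
  *Automorphic Representations of Unitary Groups in Three Variables*, Ann. of Math. Stud. 123 (1990), §4.8 Case (a) p. 53, §4.9–§4.10 pp. 55–60.
-/

set_option autoImplicit false
noncomputable section
open scoped Valued WithZero Matrix MatrixGroups

namespace Literature.NumberTheory.Automorphic.UnitaryLatticeTree

open Literature.NumberTheory.Automorphic Literature.NumberTheory.Automorphic.HermitianLattice Literature.NumberTheory.Rogawski1990

variable {K : Type*} [Field K] [Valued K ℤᵐ⁰]

/-! ## §0 Block bookkeeping for `Γ = ι(γ₂, u)` -/

omit [Valued K ℤᵐ⁰] in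
/-- Column `1` of `ι(γ₂, u)` is `u·e₁`. [cite: Rogawski1990, §4.8 Case (a) p. 53] -/
theorem endoGL_col_one (γ₂ : GL (Fin 2) K) (u : GL (Fin 1) K) (l : Fin 3) (hl : l ≠ 1) :
    ((endoGL (γ₂, u) : GL (Fin 3) K) : Matrix (Fin 3) (Fin 3) K) l 1 = 0 := by
  rw [coe_endoGL_eq_endoShape]; exact endoShapeForm_col _ _ l hl

omit [Valued K ℤᵐ⁰] in
/-- Row `1` of `ι(γ₂, u)` vanishes off the diagonal (`ι(γ₂, u)` preserves `W`). [cite: Rogawski1990, §4.8 Case (a) p. 53] -/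
theorem endoGL_row_one (γ₂ : GL (Fin 2) K) (u : GL (Fin 1) K) (l : Fin 3) (hl : l ≠ 1) :
    ((endoGL (γ₂, u) : GL (Fin 3) K) : Matrix (Fin 3) (Fin 3) K) 1 l = 0 := by
  rw [coe_endoGL_eq_endoShape]; exact endoShapeForm_row _ _ l hl

omit [Valued K ℤᵐ⁰] in
/-- The middle entry of `ι(γ₂, u)` is `u`. [cite: Rogawski1990, §4.8 Case (a) p. 53] -/
theorem endoGL_one_one (γ₂ : GL (Fin 2) K) (u : GL (Fin 1) K) :
    ((endoGL (γ₂, u) : GL (Fin 3) K) : Matrix (Fin 3) (Fin 3) K) 1 1 = (u : Matrix (Fin 1) (Fin 1) K) 0 0 := by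
  rw [coe_endoGL_eq_endoShape]; rfl

omit [Valued K ℤᵐ⁰] in
/-- `ι(γ₂, u)` acts on `W` through `γ₂`: `Γ·(y₀, 0, y₁) = ((γ₂y)₀, 0, (γ₂y)₁)`. [cite: Rogawski1990, §4.8 Case (a) p. 53] -/
theorem endoGL_mulVec_plane (γ₂ : GL (Fin 2) K) (u : GL (Fin 1) K) (y : Fin 2 → K) :
    ((endoGL (γ₂, u) : GL (Fin 3) K) : Matrix (Fin 3) (Fin 3) K) *ᵥ (![y 0, 0, y 1] : Fin 3 → K) =
      ![((γ₂ : Matrix (Fin 2) (Fin 2) K) *ᵥ y) 0, 0, ((γ₂ : Matrix (Fin 2) (Fin 2) K) *ᵥ y) 1] := by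
  rw [coe_endoGL_eq_endoShape]
  ext i
  fin_cases i <;> simp [Matrix.mulVec, dotProduct, Fin.sum_univ_three, Fin.sum_univ_two]

omit [Valued K ℤᵐ⁰] in
/-- A vector of `W` is the plane vector of its outer coordinates: `w₁ = 0 ⇒ w = (w₀, 0, w₂)`. [cite: BruhatTits1972, §10] -/
theorem eq_plane_of_apply_one_eq_zero {w : Fin 3 → K} (hw : w 1 = 0) : w = ![w 0, 0, w 2] := by
  ext i; fin_cases i <;> simp [hw]

omit [Valued K ℤᵐ⁰] in
/-- `ι(γ₂, u)` on a vector of `W`, in plane coordinates. [cite: Rogawski1990, §4.8 Case (a) p. 53] -/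
theorem endoGL_mulVec_of_apply_one_eq_zero (γ₂ : GL (Fin 2) K) (u : GL (Fin 1) K) {w : Fin 3 → K} (hw : w 1 = 0) :
    ((endoGL (γ₂, u) : GL (Fin 3) K) : Matrix (Fin 3) (Fin 3) K) *ᵥ w =
      ![((γ₂ : Matrix (Fin 2) (Fin 2) K) *ᵥ ![w 0, w 2]) 0, 0, ((γ₂ : Matrix (Fin 2) (Fin 2) K) *ᵥ ![w 0, w 2]) 1] := by
  conv_lhs => rw [eq_plane_of_apply_one_eq_zero hw]
  exact endoGL_mulVec_plane γ₂ u ![w 0, w 2]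

/-! ## §1 Fixed ⟺ stable for self-dual lattices; the `Γ`-fixed refinement of the glue fibre -/

/-- **FIXED ⟺ STABLE for a SELF-DUAL lattice under a UNITARY element**: `Γ·M = M ⟺ Γ·M ⊆ M` (`Γ ∈ U(σ, H)`, `det H` a unit, `σ` valuation-preserving).
`⇐`: `M = M^♯ ⊆ (Γ·M)^♯ = Γ·M^♯ = Γ·M` by ★ antitonicity and ★ `U(σ,H)`-equivariance of the dual. [cite: Jacobowitz1962, §4] [cite: BruhatTits1972, §10] [cite: Kottwitz1986BaseChangeUnits, §1 pp. 240–241] -/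
theorem mapGL_eq_iff_forall_mulVec_mem_of_isSelfDualLattice {N : ℕ} {σ : K →+* K} (hvσ : ∀ a, Valued.v (σ a) = Valued.v a) {ϖ : K}
    {H : Matrix (Fin N) (Fin N) K} (hH : IsUnit H.det) {Γ : GL (Fin N) K} (hΓ : Γ ∈ unitaryGroupOfForm σ H)
    {M : Submodule 𝒪[K] (Fin N → K)} (hM : IsSelfDualLattice σ ϖ H M) :
    mapGL Γ M = M ↔ ∀ x ∈ M, (Γ : Matrix (Fin N) (Fin N) K) *ᵥ x ∈ M := by
  constructor
  · intro h x hx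
    have hx' : (Γ : Matrix (Fin N) (Fin N) K) *ᵥ x ∈ mapGL Γ M :=
      Submodule.mem_map.2 ⟨x, hx, by rw [LinearMap.restrictScalars_apply, Matrix.toLin'_apply]⟩
    rwa [h] at hx'
  · intro h
    have hle : mapGL Γ M ≤ M := by
      rintro _ ⟨x, hx, rfl⟩
      rw [LinearMap.restrictScalars_apply, Matrix.toLin'_apply]
      exact h x hx
    refine le_antisymm hle ?_
    have hself := dualLatt_eq_self_of_isSelfDualLattice hvσ hH hM
    calc M = dualLatt σ H M := hself.symm
      _ ≤ dualLatt σ H (mapGL Γ M) := dualLatt_antitone σ H hle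
      _ = mapGL Γ (dualLatt σ H M) := dualLatt_mapGL hΓ M
      _ = mapGL Γ M := by rw [hself]

/-- **THE Γ-FIXED REFINEMENT OF THE GLUE FIBRE.**  Let `M` be SELF-DUAL for the block form `H` (`det H₂` a unit, `|h| = 1`) with tube coordinate `b ≥ 1`
(`c·e₁ ∈ M ⟺ |c| ≤ |ϖ|^b`, `|x₁|·|ϖ|^b ≤ 1` on `M`) and generator `x₀ ∈ M` (`|x₀,₁|·|ϖ|^b = 1`), so that `M = B ⊔ 𝒪x₀` with `B = M ∩ W` (★ T2a `glueData_of_generator`); let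
`Γ = ι(γ₂, u) ∈ U(σ, H)` be a block element with `|u| ≤ 1`.  Then
`Γ·M = M ⟺ (∀ y ∈ B, Γ y ∈ B) ∧ (Γ·pr_W x₀ − u·pr_W x₀ ∈ B)`, `pr_W x₀ = x₀ − x₀,₁e₁`
— fixedness is stability (§1), stability is the ★ one-generator tube test (TC′) on the cyclic quotient `pr_W M ∕ B = 𝒪·pr_W x₀`, and both witnesses lie in `W` by the row shape of `Γ`.
[cite: Kottwitz1986BaseChangeUnits, §1 pp. 240–241] [cite: Rogawski1990, §4.9–§4.10 pp. 55–60] [cite: BruhatTits1972, §10] [cite: Jacobowitz1962, §4] -/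
theorem mapGL_endoGL_eq_iff_of_generator (σ : K →+* K) (hvσ : ∀ a, Valued.v (σ a) = Valued.v a) {ϖ : K} (hϖ : Valued.v ϖ = WithZero.exp (-1 : ℤ))
    {H₂ : Matrix (Fin 2) (Fin 2) K} (hH₂ : IsUnit H₂.det) {h : K} (hh : Valued.v h = 1)
    {M : Submodule 𝒪[K] (Fin 3 → K)} (hM : IsSelfDualLattice σ ϖ (!![H₂ 0 0, 0, H₂ 0 1; 0, h, 0; H₂ 1 0, 0, H₂ 1 1] : Matrix (Fin 3) (Fin 3) K) M) {b : ℕ} (hb1 : 1 ≤ b)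
    (hb : ∀ c : K, (Pi.single 1 c : Fin 3 → K) ∈ M ↔ Valued.v c ≤ Valued.v ϖ ^ b) (hpr : ∀ x ∈ M, Valued.v (x 1) * Valued.v ϖ ^ b ≤ 1)
    {x₀ : Fin 3 → K} (hx₀ : x₀ ∈ M) (hx₀1 : Valued.v (x₀ 1) * Valued.v ϖ ^ b = 1)
    (γ₂ : GL (Fin 2) K) (u : GL (Fin 1) K) (hΓ : endoGL (γ₂, u) ∈ unitaryGroupOfForm σ (!![H₂ 0 0, 0, H₂ 0 1; 0, h, 0; H₂ 1 0, 0, H₂ 1 1] : Matrix (Fin 3) (Fin 3) K))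
    (hu : Valued.v ((u : Matrix (Fin 1) (Fin 1) K) 0 0) ≤ 1) :
    mapGL (endoGL (γ₂, u)) M = M ↔
      (∀ y ∈ M ⊓ LinearMap.ker ((LinearMap.proj (1 : Fin 3) : (Fin 3 → K) →ₗ[K] K).restrictScalars 𝒪[K]),
          ((endoGL (γ₂, u) : GL (Fin 3) K) : Matrix (Fin 3) (Fin 3) K) *ᵥ y ∈
            M ⊓ LinearMap.ker ((LinearMap.proj (1 : Fin 3) : (Fin 3 → K) →ₗ[K] K).restrictScalars 𝒪[K])) ∧
        ((endoGL (γ₂, u) : GL (Fin 3) K) : Matrix (Fin 3) (Fin 3) K) *ᵥ (x₀ - Pi.single 1 (x₀ 1)) -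
            (u : Matrix (Fin 1) (Fin 1) K) 0 0 • (x₀ - Pi.single 1 (x₀ 1)) ∈
          M ⊓ LinearMap.ker ((LinearMap.proj (1 : Fin 3) : (Fin 3 → K) →ₗ[K] K).restrictScalars 𝒪[K]) := by
  set S : Matrix (Fin 3) (Fin 3) K := ((endoGL (γ₂, u) : GL (Fin 3) K) : Matrix (Fin 3) (Fin 3) K) with hS
  have hcol : ∀ l : Fin 3, l ≠ 1 → S l 1 = 0 := endoGL_col_one γ₂ u
  have hrow : ∀ l : Fin 3, l ≠ 1 → S 1 l = 0 := endoGL_row_one γ₂ u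
  have hS11 : S 1 1 = (u : Matrix (Fin 1) (Fin 1) K) 0 0 := endoGL_one_one γ₂ u
  have hu' : Valued.v (S 1 1) ≤ 1 := by rw [hS11]; exact hu
  have hHdet := isUnit_det_endoShapeForm hH₂ hh
  rw [mapGL_eq_iff_forall_mulVec_mem_of_isSelfDualLattice hvσ hHdet hΓ hM]
  -- the cyclic quotient `pr_W M ∕ B` is generated by `pr_W x₀`
  obtain ⟨hgen, -⟩ := exists_smul_add_of_tubeCoordinate σ hvσ hϖ hh hM hb1 hb hpr hx₀ hx₀1
  have hgen' : ∀ x ∈ M, ∃ (c : K) (w : Fin 3 → K), Valued.v c ≤ 1 ∧ w ∈ M ∧ w 1 = 0 ∧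
      x - Pi.single 1 (x 1) = c • (x₀ - Pi.single 1 (x₀ 1)) + w := by
    intro x hx
    obtain ⟨c, w, hc, hwM, hw1, rfl⟩ := hgen x hx
    exact ⟨c, w, hc, hwM, hw1, proj_smul_add_of_apply_one_eq_zero c x₀ w hw1⟩
  constructor
  · intro hSM
    refine ⟨fun y hy => ?_, ?_⟩
    · obtain ⟨h1, h2⟩ := mulVec_mem_inf_of_forall_mulVec_mem 1 hrow hSM hy.1 ((mem_kerProj_one_iff y).1 hy.2)
      exact ⟨h1, (mem_kerProj_one_iff _).2 h2⟩
    · obtain ⟨h1, h2⟩ := sub_smul_mulVec_proj_mem_of_forall_mulVec_mem 1 hcol hrow hu' hSM hx₀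
      rw [hS11] at h1 h2
      exact ⟨h1, (mem_kerProj_one_iff _).2 h2⟩
  · rintro ⟨hB, hx⟩
    refine (forall_mulVec_mem_iff_sub_smul_mulVec_proj_mem_of_generator 1 hcol hrow hu' hx₀ hgen' fun w hw hw1 => ?_).2 ?_
    · exact (hB w ⟨hw, (mem_kerProj_one_iff w).2 hw1⟩).1
    · rw [hS11]; exact hx.1

/-! ## §2 The axis fibre `b = 0`: self-dual lattices through `e₁` -/

/-- On a self-dual `M` (block form, `|h| = 1`) containing `e₁`, every middle coordinate is integral: `|x₁| ≤ 1` (`M ≤ M^♯ ≤ (𝒪e₁)^♯`). [cite: Jacobowitz1962, §4] -/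
theorem v_apply_one_le_one_of_single_one_mem (σ : K →+* K) (hvσ : ∀ a, Valued.v (σ a) = Valued.v a) {ϖ : K}
    {H₂ : Matrix (Fin 2) (Fin 2) K} {h : K} (hh : Valued.v h = 1)
    {M : Submodule 𝒪[K] (Fin 3 → K)} (hM : IsSelfDualLattice σ ϖ (!![H₂ 0 0, 0, H₂ 0 1; 0, h, 0; H₂ 1 0, 0, H₂ 1 1] : Matrix (Fin 3) (Fin 3) K) M)
    (he : (Pi.single 1 1 : Fin 3 → K) ∈ M) {x : Fin 3 → K} (hx : x ∈ M) : Valued.v (x 1) ≤ 1 := by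
  have hMd := le_dualLatt_of_isVertexLattice hvσ hM
  have hle : Submodule.span 𝒪[K] {(Pi.single 1 1 : Fin 3 → K)} ≤ M := (Submodule.span_singleton_le_iff_mem _ _).2 he
  exact (mem_dualLatt_span_single_one_iff σ hvσ hh x).1 (dualLatt_antitone σ _ hle (hMd hx))

/-- On a self-dual `M` (block form) through `e₁`: `pr_W x ∈ M ∩ W` for every `x ∈ M` (the projection of `M` IS its `W`-part). [cite: BruhatTits1972, §10] [cite: Jacobowitz1962, §4] -/
theorem sub_single_mem_inf_kerProj_of_single_one_mem (σ : K →+* K) (hvσ : ∀ a, Valued.v (σ a) = Valued.v a) {ϖ : K}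
    {H₂ : Matrix (Fin 2) (Fin 2) K} {h : K} (hh : Valued.v h = 1)
    {M : Submodule 𝒪[K] (Fin 3 → K)} (hM : IsSelfDualLattice σ ϖ (!![H₂ 0 0, 0, H₂ 0 1; 0, h, 0; H₂ 1 0, 0, H₂ 1 1] : Matrix (Fin 3) (Fin 3) K) M)
    (he : (Pi.single 1 1 : Fin 3 → K) ∈ M) {x : Fin 3 → K} (hx : x ∈ M) :
    x - Pi.single 1 (x 1) ∈ M ⊓ LinearMap.ker ((LinearMap.proj (1 : Fin 3) : (Fin 3 → K) →ₗ[K] K).restrictScalars 𝒪[K]) := by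
  have hx1 := v_apply_one_le_one_of_single_one_mem σ hvσ hh hM he hx
  refine ⟨M.sub_mem hx ?_, (mem_kerProj_one_iff _).2 (by simp)⟩
  have hsm := M.smul_mem (⟨x 1, (mem_integer_iff' _).2 hx1⟩ : 𝒪[K]) he
  have e : ((⟨x 1, (mem_integer_iff' _).2 hx1⟩ : 𝒪[K]) • (Pi.single 1 1 : Fin 3 → K)) = Pi.single 1 (x 1) := by
    change (x 1) • (Pi.single 1 (1 : K) : Fin 3 → K) = Pi.single 1 (x 1)
    rw [← Pi.single_smul, smul_eq_mul, mul_one]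
  rwa [e] at hsm

/-- **A self-dual lattice through `e₁` splits along the blocks**: `M = (M ∩ W) ⊔ 𝒪e₁`. [cite: BruhatTits1972, §10] [cite: Kottwitz1986BaseChangeUnits, §1 pp. 240–241] -/
theorem eq_inf_kerProj_sup_span_single_one (σ : K →+* K) (hvσ : ∀ a, Valued.v (σ a) = Valued.v a) {ϖ : K}
    {H₂ : Matrix (Fin 2) (Fin 2) K} {h : K} (hh : Valued.v h = 1)
    {M : Submodule 𝒪[K] (Fin 3 → K)} (hM : IsSelfDualLattice σ ϖ (!![H₂ 0 0, 0, H₂ 0 1; 0, h, 0; H₂ 1 0, 0, H₂ 1 1] : Matrix (Fin 3) (Fin 3) K) M)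
    (he : (Pi.single 1 1 : Fin 3 → K) ∈ M) :
    M = M ⊓ LinearMap.ker ((LinearMap.proj (1 : Fin 3) : (Fin 3 → K) →ₗ[K] K).restrictScalars 𝒪[K]) ⊔ Submodule.span 𝒪[K] {(Pi.single 1 1 : Fin 3 → K)} := by
  refine le_antisymm (fun x hx => ?_) (sup_le inf_le_left ((Submodule.span_singleton_le_iff_mem _ _).2 he))
  have hx1 := v_apply_one_le_one_of_single_one_mem σ hvσ hh hM he hx
  rw [mem_sup_span_singleton_iff]
  refine ⟨x 1, hx1, ?_⟩
  have e : (x 1) • (Pi.single 1 (1 : K) : Fin 3 → K) = Pi.single 1 (x 1) := by rw [← Pi.single_smul, smul_eq_mul, mul_one]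
  rw [e]
  exact sub_single_mem_inf_kerProj_of_single_one_mem σ hvσ hh hM he hx

/-- **THE AXIS FIBRE `b = 0`: FIXED ⟺ THE `W`-PART IS STABLE.**  For a self-dual `M` (block form, `det H₂` a unit, `|h| = 1`) with `e₁ ∈ M` and a block element
`Γ = ι(γ₂, u) ∈ U(σ, H)`, `|u| ≤ 1`:  `Γ·M = M ⟺ ∀ y ∈ M ∩ W, Γ y ∈ M ∩ W` (§1 + (TC) with the witnesses `(Γ − u)·pr_W x = Γ y − u y`, `y = pr_W x ∈ M ∩ W`).
[cite: Kottwitz1986BaseChangeUnits, §1 pp. 240–241] [cite: Rogawski1990, §4.9 p. 55] [cite: BruhatTits1972, §10] -/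
theorem mapGL_endoGL_eq_iff_of_single_one_mem (σ : K →+* K) (hvσ : ∀ a, Valued.v (σ a) = Valued.v a) {ϖ : K}
    {H₂ : Matrix (Fin 2) (Fin 2) K} (hH₂ : IsUnit H₂.det) {h : K} (hh : Valued.v h = 1)
    {M : Submodule 𝒪[K] (Fin 3 → K)} (hM : IsSelfDualLattice σ ϖ (!![H₂ 0 0, 0, H₂ 0 1; 0, h, 0; H₂ 1 0, 0, H₂ 1 1] : Matrix (Fin 3) (Fin 3) K) M)
    (he : (Pi.single 1 1 : Fin 3 → K) ∈ M)
    (γ₂ : GL (Fin 2) K) (u : GL (Fin 1) K) (hΓ : endoGL (γ₂, u) ∈ unitaryGroupOfForm σ (!![H₂ 0 0, 0, H₂ 0 1; 0, h, 0; H₂ 1 0, 0, H₂ 1 1] : Matrix (Fin 3) (Fin 3) K))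
    (hu : Valued.v ((u : Matrix (Fin 1) (Fin 1) K) 0 0) ≤ 1) :
    mapGL (endoGL (γ₂, u)) M = M ↔
      ∀ y ∈ M ⊓ LinearMap.ker ((LinearMap.proj (1 : Fin 3) : (Fin 3 → K) →ₗ[K] K).restrictScalars 𝒪[K]),
        ((endoGL (γ₂, u) : GL (Fin 3) K) : Matrix (Fin 3) (Fin 3) K) *ᵥ y ∈
          M ⊓ LinearMap.ker ((LinearMap.proj (1 : Fin 3) : (Fin 3 → K) →ₗ[K] K).restrictScalars 𝒪[K]) := by
  set S : Matrix (Fin 3) (Fin 3) K := ((endoGL (γ₂, u) : GL (Fin 3) K) : Matrix (Fin 3) (Fin 3) K) with hS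
  have hcol : ∀ l : Fin 3, l ≠ 1 → S l 1 = 0 := endoGL_col_one γ₂ u
  have hrow : ∀ l : Fin 3, l ≠ 1 → S 1 l = 0 := endoGL_row_one γ₂ u
  have hS11 : S 1 1 = (u : Matrix (Fin 1) (Fin 1) K) 0 0 := endoGL_one_one γ₂ u
  have hu' : Valued.v (S 1 1) ≤ 1 := by rw [hS11]; exact hu
  have hHdet := isUnit_det_endoShapeForm hH₂ hh
  rw [mapGL_eq_iff_forall_mulVec_mem_of_isSelfDualLattice hvσ hHdet hΓ hM]
  constructor
  · intro hSM y hy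
    obtain ⟨h1, h2⟩ := mulVec_mem_inf_of_forall_mulVec_mem 1 hrow hSM hy.1 ((mem_kerProj_one_iff y).1 hy.2)
    exact ⟨h1, (mem_kerProj_one_iff _).2 h2⟩
  · intro hB x hx
    have hprx := sub_single_mem_inf_kerProj_of_single_one_mem σ hvσ hh hM he hx
    refine mulVec_mem_of_forall_sub_smul_mulVec_proj_mem 1 hcol hu' (fun y hy => ?_) hx
    have hpry := sub_single_mem_inf_kerProj_of_single_one_mem σ hvσ hh hM he hy
    exact M.sub_mem (hB _ hpry).1 (M.smul_mem (⟨S 1 1, (mem_integer_iff' _).2 hu'⟩ : 𝒪[K]) hpry.1)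

/-! ## §3 The plane bridge `ι_W : K² → W`, `ι_W y = (y₀, 0, y₁)` -/

omit [Valued K ℤᵐ⁰] in
/-- The plane embedding as a matrix: `!![1, 0; 0, 0; 0, 1] *ᵥ y = (y₀, 0, y₁)`. [cite: BruhatTits1972, §10] -/
theorem planeMatrix_mulVec (y : Fin 2 → K) : (!![1, 0; 0, 0; 0, 1] : Matrix (Fin 3) (Fin 2) K) *ᵥ y = ![y 0, 0, y 1] := by
  ext i; fin_cases i <;> simp [Matrix.mulVec, dotProduct, Fin.sum_univ_two]

omit [Valued K ℤᵐ⁰] in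
/-- **The block form restricts to `H₂` on `W`**: `⟨(x₀, 0, x₁), (y₀, 0, y₁)⟩_H = ⟨x, y⟩_{H₂}`. [cite: Jacobowitz1962, §4] [cite: Rogawski1990, §4.8 Case (a) p. 53] -/
theorem pairing_endoShapeForm_plane (σ : K →+* K) (H₂ : Matrix (Fin 2) (Fin 2) K) (h : K) (x y : Fin 2 → K) :
    pairing σ (!![H₂ 0 0, 0, H₂ 0 1; 0, h, 0; H₂ 1 0, 0, H₂ 1 1] : Matrix (Fin 3) (Fin 3) K) ![x 0, 0, x 1] ![y 0, 0, y 1] = pairing σ H₂ x y := by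
  simp [pairing_apply, Fin.sum_univ_three, Fin.sum_univ_two]

/-- Membership in the embedded plane lattice `B₂.map ι_W`: `w ∈ ι_W(B₂) ⟺ w₁ = 0 ∧ (w₀, w₂) ∈ B₂`. [cite: BruhatTits1972, §10] -/
theorem mem_map_planeMatrix_iff (B₂ : Submodule 𝒪[K] (Fin 2 → K)) (w : Fin 3 → K) :
    w ∈ B₂.map ((Matrix.toLin' (!![1, 0; 0, 0; 0, 1] : Matrix (Fin 3) (Fin 2) K)).restrictScalars 𝒪[K]) ↔ w 1 = 0 ∧ (![w 0, w 2] : Fin 2 → K) ∈ B₂ := by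
  constructor
  · rintro ⟨y, hy, rfl⟩
    rw [LinearMap.restrictScalars_apply, Matrix.toLin'_apply, planeMatrix_mulVec]
    refine ⟨by simp, ?_⟩
    have e : (![(![y 0, 0, y 1] : Fin 3 → K) 0, (![y 0, 0, y 1] : Fin 3 → K) 2] : Fin 2 → K) = y := by
      ext i; fin_cases i <;> simp
    rw [e]; exact hy
  · rintro ⟨hw1, hw⟩
    refine ⟨![w 0, w 2], hw, ?_⟩
    rw [LinearMap.restrictScalars_apply, Matrix.toLin'_apply, planeMatrix_mulVec, eq_plane_of_apply_one_eq_zero hw1]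
    ext i; fin_cases i <;> simp

/-- **`Γ`-STABILITY OF THE `W`-PART, READ ON THE PLANE**: `Γ·ι_W(B₂) ⊆ ι_W(B₂) ⟺ γ₂·B₂ ⊆ B₂`. [cite: Kottwitz1986BaseChangeUnits, §1 pp. 240–241] [cite: Rogawski1990, §4.8 Case (a) p. 53] -/
theorem forall_endoGL_mulVec_mem_map_planeMatrix_iff (γ₂ : GL (Fin 2) K) (u : GL (Fin 1) K) (B₂ : Submodule 𝒪[K] (Fin 2 → K)) :
    (∀ w ∈ B₂.map ((Matrix.toLin' (!![1, 0; 0, 0; 0, 1] : Matrix (Fin 3) (Fin 2) K)).restrictScalars 𝒪[K]),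
        ((endoGL (γ₂, u) : GL (Fin 3) K) : Matrix (Fin 3) (Fin 3) K) *ᵥ w ∈
          B₂.map ((Matrix.toLin' (!![1, 0; 0, 0; 0, 1] : Matrix (Fin 3) (Fin 2) K)).restrictScalars 𝒪[K])) ↔
      ∀ y ∈ B₂, (γ₂ : Matrix (Fin 2) (Fin 2) K) *ᵥ y ∈ B₂ := by
  have key : ∀ y : Fin 2 → K, (![(![((γ₂ : Matrix (Fin 2) (Fin 2) K) *ᵥ y) 0, 0, ((γ₂ : Matrix (Fin 2) (Fin 2) K) *ᵥ y) 1] : Fin 3 → K) 0,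
      (![((γ₂ : Matrix (Fin 2) (Fin 2) K) *ᵥ y) 0, 0, ((γ₂ : Matrix (Fin 2) (Fin 2) K) *ᵥ y) 1] : Fin 3 → K) 2] : Fin 2 → K) =
        (γ₂ : Matrix (Fin 2) (Fin 2) K) *ᵥ y := fun y => by
    ext i; fin_cases i <;> simp
  constructor
  · intro hst y hy
    have hw : (![y 0, 0, y 1] : Fin 3 → K) ∈ B₂.map ((Matrix.toLin' (!![1, 0; 0, 0; 0, 1] : Matrix (Fin 3) (Fin 2) K)).restrictScalars 𝒪[K]) := by
      rw [mem_map_planeMatrix_iff]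
      refine ⟨by simp, ?_⟩
      have e : (![(![y 0, 0, y 1] : Fin 3 → K) 0, (![y 0, 0, y 1] : Fin 3 → K) 2] : Fin 2 → K) = y := by ext i; fin_cases i <;> simp
      rw [e]; exact hy
    have h := hst _ hw
    rw [endoGL_mulVec_plane, mem_map_planeMatrix_iff, key] at h
    exact h.2
  · intro hst w hw
    obtain ⟨hw1, hwB⟩ := (mem_map_planeMatrix_iff B₂ w).1 hw
    rw [endoGL_mulVec_of_apply_one_eq_zero γ₂ u hw1, mem_map_planeMatrix_iff, key]
    exact ⟨by simp, hst _ hwB⟩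

/-- **THE GENERATOR CONDITION, READ ON THE PLANE**: for `pr_W x₀ = ι_W w₀`, `Γ·pr_W x₀ − u·pr_W x₀ ∈ ι_W(B₂) ⟺ γ₂ w₀ − u w₀ ∈ B₂`. [cite: Kottwitz1986BaseChangeUnits, §1 pp. 240–241] -/
theorem endoGL_mulVec_plane_sub_smul_mem_map_planeMatrix_iff (γ₂ : GL (Fin 2) K) (u : GL (Fin 1) K) (B₂ : Submodule 𝒪[K] (Fin 2 → K)) (w₀ : Fin 2 → K) :
    ((endoGL (γ₂, u) : GL (Fin 3) K) : Matrix (Fin 3) (Fin 3) K) *ᵥ (![w₀ 0, 0, w₀ 1] : Fin 3 → K) - (u : Matrix (Fin 1) (Fin 1) K) 0 0 • (![w₀ 0, 0, w₀ 1] : Fin 3 → K) ∈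
        B₂.map ((Matrix.toLin' (!![1, 0; 0, 0; 0, 1] : Matrix (Fin 3) (Fin 2) K)).restrictScalars 𝒪[K]) ↔
      (γ₂ : Matrix (Fin 2) (Fin 2) K) *ᵥ w₀ - (u : Matrix (Fin 1) (Fin 1) K) 0 0 • w₀ ∈ B₂ := by
  rw [endoGL_mulVec_plane, mem_map_planeMatrix_iff]
  have e : (![(![((γ₂ : Matrix (Fin 2) (Fin 2) K) *ᵥ w₀) 0, 0, ((γ₂ : Matrix (Fin 2) (Fin 2) K) *ᵥ w₀) 1] - (u : Matrix (Fin 1) (Fin 1) K) 0 0 • ![w₀ 0, 0, w₀ 1] : Fin 3 → K) 0,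
      (![((γ₂ : Matrix (Fin 2) (Fin 2) K) *ᵥ w₀) 0, 0, ((γ₂ : Matrix (Fin 2) (Fin 2) K) *ᵥ w₀) 1] - (u : Matrix (Fin 1) (Fin 1) K) 0 0 • ![w₀ 0, 0, w₀ 1] : Fin 3 → K) 2] : Fin 2 → K) =
        (γ₂ : Matrix (Fin 2) (Fin 2) K) *ᵥ w₀ - (u : Matrix (Fin 1) (Fin 1) K) 0 0 • w₀ := by
    ext i; fin_cases i <;> simp
  rw [e]
  exact ⟨fun hx => hx.2, fun hx => ⟨by simp, hx⟩⟩

/-- **THE GLUING CONDITION (G1) ON THE PLANE.**  For a plane lattice `B₂ ⊆ K²`, a vector `x₀ ∈ K³` with `pr_W x₀ = ι_W w₀`, and the block form `H` (row `1` = `h·e₁`): ★ T2a's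
condition (G1) «`ι_W(B₂)` is the `W`-dual of `ι_W(B₂) + 𝒪·pr_W x₀`» — i.e. for `w ∈ W`: `w ∈ ι_W(B₂) ⟺ (∀ y ∈ ι_W(B₂), |⟨y, w⟩_H| ≤ 1) ∧ |⟨x₀, w⟩_H| ≤ 1` — holds iff
`(B₂ ⊔ 𝒪w₀)^♯ = B₂` for `H₂` (★ `mem_dualLatt_sup_span_iff`; `⟨x₀, w⟩_H = ⟨pr_W x₀, w⟩_H` on `W`, ★ `pairing_sub_single_left_of_block`).  The hinge between the glue fibre (★ T2a §3
`glued_of_glueData`) and the plane-side census. [cite: Jacobowitz1962, §4] [cite: BruhatTits1972, §10] [cite: Kottwitz1986BaseChangeUnits, §1 pp. 240–241] -/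
theorem glueCondition_map_planeMatrix_iff_dualLatt_sup_span_eq {σ : K →+* K} (hvσ : ∀ a, Valued.v (σ a) = Valued.v a) (H₂ : Matrix (Fin 2) (Fin 2) K) (h : K)
    (B₂ : Submodule 𝒪[K] (Fin 2 → K)) {x₀ : Fin 3 → K} {w₀ : Fin 2 → K} (hx₀ : x₀ - Pi.single 1 (x₀ 1) = ![w₀ 0, 0, w₀ 1]) :
    (∀ w : Fin 3 → K, w 1 = 0 →
        (w ∈ B₂.map ((Matrix.toLin' (!![1, 0; 0, 0; 0, 1] : Matrix (Fin 3) (Fin 2) K)).restrictScalars 𝒪[K]) ↔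
          (∀ y ∈ B₂.map ((Matrix.toLin' (!![1, 0; 0, 0; 0, 1] : Matrix (Fin 3) (Fin 2) K)).restrictScalars 𝒪[K]),
              Valued.v (pairing σ (!![H₂ 0 0, 0, H₂ 0 1; 0, h, 0; H₂ 1 0, 0, H₂ 1 1] : Matrix (Fin 3) (Fin 3) K) y w) ≤ 1) ∧
            Valued.v (pairing σ (!![H₂ 0 0, 0, H₂ 0 1; 0, h, 0; H₂ 1 0, 0, H₂ 1 1] : Matrix (Fin 3) (Fin 3) K) x₀ w) ≤ 1)) ↔
      dualLatt σ H₂ (B₂ ⊔ Submodule.span 𝒪[K] {w₀}) = B₂ := by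
  set H : Matrix (Fin 3) (Fin 3) K := !![H₂ 0 0, 0, H₂ 0 1; 0, h, 0; H₂ 1 0, 0, H₂ 1 1] with hHdef
  set ι := ((Matrix.toLin' (!![1, 0; 0, 0; 0, 1] : Matrix (Fin 3) (Fin 2) K)).restrictScalars 𝒪[K]) with hι
  have hHrow : ∀ l : Fin 3, l ≠ 1 → H 1 l = 0 := fun l hl => endoShapeForm_row H₂ h l hl
  -- the three readings on a plane vector `w = ι z`
  have hmem : ∀ z : Fin 2 → K, (![z 0, 0, z 1] : Fin 3 → K) ∈ B₂.map ι ↔ z ∈ B₂ := fun z => by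
    rw [mem_map_planeMatrix_iff]
    have e : (![(![z 0, 0, z 1] : Fin 3 → K) 0, (![z 0, 0, z 1] : Fin 3 → K) 2] : Fin 2 → K) = z := by ext i; fin_cases i <;> simp
    rw [e]; exact ⟨fun hz => hz.2, fun hz => ⟨by simp, hz⟩⟩
  have hdual : ∀ z : Fin 2 → K, (∀ y ∈ B₂.map ι, Valued.v (pairing σ H y ![z 0, 0, z 1]) ≤ 1) ↔ ∀ y₂ ∈ B₂, Valued.v (pairing σ H₂ y₂ z) ≤ 1 := fun z => by
    constructor
    · intro hy y₂ hy₂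
      rw [← pairing_endoShapeForm_plane σ H₂ h y₂ z]
      exact hy _ ((hmem y₂).2 hy₂)
    · intro hy y hyB
      obtain ⟨hy1, hyB₂⟩ := (mem_map_planeMatrix_iff B₂ y).1 hyB
      have hyz : y = ![(![y 0, y 2] : Fin 2 → K) 0, 0, (![y 0, y 2] : Fin 2 → K) 1] := by ext i; fin_cases i <;> simp [hy1]
      rw [hyz, pairing_endoShapeForm_plane]
      exact hy _ hyB₂
  have hx₀z : ∀ z : Fin 2 → K, pairing σ H x₀ ![z 0, 0, z 1] = pairing σ H₂ w₀ z := fun z => by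
    rw [← pairing_sub_single_left_of_block σ H 1 hHrow x₀ (show (![z 0, 0, z 1] : Fin 3 → K) 1 = 0 by simp), hx₀, pairing_endoShapeForm_plane]
  constructor
  · intro hG1
    ext z
    rw [mem_dualLatt_sup_span_iff hvσ]
    have h := hG1 ![z 0, 0, z 1] (by simp)
    rw [hmem, hdual, hx₀z] at h
    exact h.symm
  · intro hd w hw1
    have hwz : w = ![(![w 0, w 2] : Fin 2 → K) 0, 0, (![w 0, w 2] : Fin 2 → K) 1] := by ext i; fin_cases i <;> simp [hw1]
    rw [hwz, hmem, hdual, hx₀z]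
    have h := Submodule.ext_iff.1 hd ![w 0, w 2]
    rw [mem_dualLatt_sup_span_iff hvσ] at h
    exact h.symm

/-! ## §4 The `W`-part of an axis lattice, in plane currency -/

/-- **THE `W`-PART OF AN AXIS LATTICE IS A SELF-DUAL PLANE LATTICE.**  For a self-dual `M` (block form; `σ` an isometric involution, `H₂` hermitian with unit determinant,
`|h| = 1`, `σh = h`) through `e₁`: `M ∩ W = ι_W(g₂·𝒪²)` for some `g₂ ∈ GL₂(K)` with `g₂·𝒪²` SELF-DUAL for `H₂` — ★ (c1-iii′) `exists_axisVertex_eq_latt_endoGL` at tube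
coordinate `b = 0` (where `A(M) = M` and `(M ∩ W) + ϖ⁰·pr_W M = M ∩ W`).  With `eq_inf_kerProj_sup_span_single_one`: `M = ι_W(g₂·𝒪²) ⊔ 𝒪e₁`, the `b = 0` members of the
(ρ2b′-X) axis decomposition are in bijection with the self-dual plane lattices (LH4-p12 (g4)'s T3 currency `IsSelfDualLattice σ ϖ H₂`).  (`𝒪` a PID — every complete discretely
valued `K`.) [cite: BruhatTits1972, §10] [cite: Jacobowitz1962, §4, §7] [cite: Kottwitz1986BaseChangeUnits, §1 pp. 240–241] -/
theorem exists_isSelfDualLattice_latt_map_planeMatrix_eq_of_single_one_mem [IsPrincipalIdealRing 𝒪[K]] (σ : K →+* K) (hσ : ∀ a, σ (σ a) = a)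
    (hvσ : ∀ a, Valued.v (σ a) = Valued.v a) {ϖ : K} (hϖ : Valued.v ϖ = WithZero.exp (-1 : ℤ))
    {H₂ : Matrix (Fin 2) (Fin 2) K} (hH₂ : IsUnit H₂.det) (hH₂σ : (H₂.map σ)ᵀ = H₂) {h : K} (hh : Valued.v h = 1) (hhσ : σ h = h)
    {M : Submodule 𝒪[K] (Fin 3 → K)} (hM : IsSelfDualLattice σ ϖ (!![H₂ 0 0, 0, H₂ 0 1; 0, h, 0; H₂ 1 0, 0, H₂ 1 1] : Matrix (Fin 3) (Fin 3) K) M)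
    (he : (Pi.single 1 1 : Fin 3 → K) ∈ M) :
    ∃ g₂ : GL (Fin 2) K, IsSelfDualLattice σ ϖ H₂ (latt (g₂ : Matrix (Fin 2) (Fin 2) K)) ∧
      (latt (g₂ : Matrix (Fin 2) (Fin 2) K)).map ((Matrix.toLin' (!![1, 0; 0, 0; 0, 1] : Matrix (Fin 3) (Fin 2) K)).restrictScalars 𝒪[K]) =
        M ⊓ LinearMap.ker ((LinearMap.proj (1 : Fin 3) : (Fin 3 → K) →ₗ[K] K).restrictScalars 𝒪[K]) := by
  -- tube coordinate `0`
  have hb0 : ∀ c : K, (Pi.single 1 c : Fin 3 → K) ∈ M ↔ Valued.v c ≤ Valued.v ϖ ^ 0 := by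
    intro c
    rw [pow_zero]
    constructor
    · intro hc
      simpa using v_apply_one_le_one_of_single_one_mem σ hvσ hh hM he hc
    · intro hc
      have hsm := M.smul_mem (⟨c, (mem_integer_iff' _).2 hc⟩ : 𝒪[K]) he
      have e : ((⟨c, (mem_integer_iff' _).2 hc⟩ : 𝒪[K]) • (Pi.single 1 1 : Fin 3 → K)) = Pi.single 1 c := by
        change c • (Pi.single 1 (1 : K) : Fin 3 → K) = Pi.single 1 c
        rw [← Pi.single_smul, smul_eq_mul, mul_one]
      rwa [e] at hsm
  obtain ⟨g₂, hSD, -, hmem⟩ := exists_axisVertex_eq_latt_endoGL σ hσ hvσ hϖ hH₂ hH₂σ hh hhσ hM hb0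
  refine ⟨g₂, hSD, ?_⟩
  -- `y ∈ g₂·𝒪² ⟺ ι_W y ∈ M ∩ W`
  have key : ∀ y : Fin 2 → K, y ∈ latt (g₂ : Matrix (Fin 2) (Fin 2) K) ↔
      (![y 0, 0, y 1] : Fin 3 → K) ∈ M ∧ (![y 0, 0, y 1] : Fin 3 → K) 1 = 0 := by
    intro y
    rw [hmem y, pow_zero]
    constructor
    · rintro ⟨w, hw, m, hm, hw1, hyw⟩
      refine ⟨?_, by simp⟩
      rw [hyw, one_smul]
      exact M.add_mem hw (sub_single_mem_inf_kerProj_of_single_one_mem σ hvσ hh hM he hm).1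
    · rintro ⟨hy, -⟩
      exact ⟨![y 0, 0, y 1], hy, 0, M.zero_mem, by simp, by simp⟩
  ext w
  rw [mem_map_planeMatrix_iff, key]
  constructor
  · rintro ⟨hw1, hwM, -⟩
    have hwz : w = ![(![w 0, w 2] : Fin 2 → K) 0, 0, (![w 0, w 2] : Fin 2 → K) 1] := by ext i; fin_cases i <;> simp [hw1]
    exact ⟨hwz ▸ hwM, (mem_kerProj_one_iff w).2 hw1⟩
  · rintro ⟨hwM, hwW⟩
    have hw1 := (mem_kerProj_one_iff w).1 hwW
    have hwz : w = ![(![w 0, w 2] : Fin 2 → K) 0, 0, (![w 0, w 2] : Fin 2 → K) 1] := by ext i; fin_cases i <;> simp [hw1]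
    exact ⟨hw1, hwz ▸ hwM, by simp⟩


end Literature.NumberTheory.Automorphic.UnitaryLatticeTree

end
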